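import Summits.QuantumFields.YangMills.Theorems.UnitScaleTiltProp7FlatSliceRegularityT3
import Summits.QuantumFields.YangMills.Theorems.UnitScaleTiltProp7FlatCurrentLinearisation
import Summits.QuantumFields.YangMills.Theorems.UnitScaleTiltProp7FlatCurlCurl
import Literature.MathematicalPhysics.QuantumFieldTheory.Balaban1983to89.B6SectACriticalPointV1
import HarnessLib

/-!
# Route `UnitScaleTilt`, crux K1 child «MinimiserStabilityRegPr» (stmt-QuantumFields-19200), registered stub `stub_prop7From14` (V3, skeleton v7
# cc37a1787726) — lane B: **THE GAUGE-FREE FORM OF THE FLAT SLICE REGULARITY** — for ANY real bond field `x` (no gauge condition) the representative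
# `x − ∂λ₀` of its orbit under the restricted gauge group `N(Q′)` on print's flat Landau slice ([Balaban1984PropagatorsII] (2.12): exactly one `λ₀` with
# `R∂*(x − ∂λ₀) = 0`) has the SAME linearised current `∂*∂x`, the SAME constraint datum `Qx` and hence obeys every bound of the lane-B files in terms of
# `x`'s current remainder and datum: the LINEAR part of the gauge fixing (F1) costs nothing

Cell `ym3-torus` ∕ fleet seat `ym-ust-19200-p3` (WIDTH-LEVER lane B of V3; HUMAN RULING D-0037, YM ladder rung R3).  `--supports stmt-QuantumFields-19200
--as helper`.  Bookkeeping over lit-balaban's `B6SectACriticalPointV1.existsUnique_gauge212` («the functional (2.8) has exactly one minimum on each orbit»,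
`R∂*A^{λ₀} = 0`), `QE_dE_eq_zero` (`Q∂λ = 0` for `λ ∈ N(Q′)`) and `curlCurl_comp_dE` (`∂*∂∂ = 0`), composed with `Prop7FlatSliceRegularity(T3)`, `Prop7FlatCurrentLinearisation`, `Prop7FlatCurlCurl`.
* §1 (every `Domains D`): `exists_slice_repr` (the representative, with `Q(x − ∂λ₀) = Qx`, `∂*∂(x − ∂λ₀) = ∂*∂x`); **`exists_repr_add_GE_eq_H_of_critical`**
  ((127) for `x` ⇒ (133) for the representative: `(x − ∂λ₀) + Gr = H(Qx + QGr)`).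
* §2 (d = 3 carrier): **`exists_repr_abs_le_of_critical_T3`** — `∃ λ₀ ∈ N(Q′)`, `R∂*(x − ∂λ₀) = 0` and `|(x − ∂λ₀)(e)| ≤ C_G·B + C_H·(β + C_G·B)` from
  `⟨δ, ∂*∂x + r⟩ = 0 (Qδ = 0)`, `sup|r| ≤ B`, `sup|Q_{K−n}x| ≤ β` — NO slice hypothesis on `x`.
* §3 (nonlinear, one step): `abs_current_remainder_le_T3` (`|c²ℓ(J) − ∂*∂x| ≤ c²·3(2af + 2f² + 16ag)` for `x = ℓ∘Y`) and **`exists_repr_abs_le_of_EL_T3`** — for a unitary-valued `V = 1 + Y` in ANY near-identity presentation (e.g. a block-axial gauge: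
  `a`, `f`, `g` as in `Prop7FlatCurrentLinearisation`) and a real component `x = ℓ∘Y` whose true current component `c²ℓ∘(D^{1*}_V∂V)` is a multiplier current:
  the slice representative of `x` is bounded by `C_G·B + C_H·(β + C_G·B)`, `B = c²·3(2af + 2f² + 16ag)`.
* §4 (appended) **`exists_repr_abs_le_of_multiplier_T3`** — THE INTERFACE FOR THE E–L PORT: no exact orthogonality, only a defect
  `|c²ℓ(J)(e) − (Q*ω)(e)| ≤ p` for SOME coarse `ω`: `sup|x − ∂λ₀| ≤ C_G·(B + p) + C_H·(β + C_G·(B + p))`.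
* §5 (appended) `exists_repr_grad_le_of_multiplier_T3` — the gradient member of the port interface (`C = C(L)`).
HONEST SCOPE.  The NONLINEAR gauge fixing ([Balaban1985RegularSpaces] Thm 2/4: making the representative the Lie-algebra coordinate of a genuine gauge transform
of `V`, with the `L^{−k}` gain) is NOT touched — here `x − ∂λ₀` is the linear (abelian) representative; the Euler–Lagrange port and the datum `β` are the
consumer's, as in the prequels.  No definition, no sorry, standard axioms.  NOT a claim about the mass gap.

References: T. Bałaban, CMP **96** (1984) 223–250 [Balaban1984PropagatorsII] ((2.7)–(2.12) pp.224–225); CMP **102** (1985) 277–309 [Balaban1985Variational]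
((21) p.281, (127) p.297, (133)–(136) p.298).
-/

set_option autoImplicit false

noncomputable section

open scoped BigOperators InnerProductSpace

namespace Summit.QuantumFields.YangMills.Theorems.Prop7FlatSliceRegularityGauge

open Literature.MathematicalPhysics.QuantumFieldTheory.Balaban1983to89
open Literature.MathematicalPhysics.QuantumFieldTheory.BalabanImbrieJaffe1984to88.BIJ85AxialPropagator411 (BondSpace PlaqSpace)
open LatticeFieldCalculus B6SectADomainsV1 B6SectAOperatorsV1 B6SectAVectorModelV1 B6SectCTwoScaleV1 B6GOneLevelV1Bridge
open B6SectACriticalPointV1 (existsUnique_gauge212 QE_dE_eq_zero curlCurl_comp_dE)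
open Prop7FlatSliceRegularity (add_GE_eq_H_of_critical abs_le_of_critical_T3)

variable {P : Params}

/-! ## §1 The slice representative of the restricted gauge orbit -/

section General

variable (D : Domains P)

/-- **THE SLICE REPRESENTATIVE** ([Balaban1984PropagatorsII] (2.12)): for every real bond field `x` there is `λ₀ ∈ N(Q′)` with `R∂*(x − ∂λ₀) = 0`; the
representative has the same constraint datum (`Q∂λ₀ = 0`, Lemma S) and the same linearised current (`∂*∂∂ = 0`). [cite: Balaban1984PropagatorsII, (2.12) p.225, (2.29)-(2.30) p.227] -/
theorem exists_slice_repr {c : ℝ} (hc : c ≠ 0) (x : BondSpace P) :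
    ∃ n : ScalarSpace P, n ∈ LinearMap.ker (QpE D) ∧ RE D c (dsE c (x - dE c n)) = 0 ∧
      QE D (x - dE c n) = QE D x ∧ dcsE c (dcE c (x - dE c n)) = dcsE c (dcE c x) := by
  obtain ⟨n, ⟨hn, hR⟩, -⟩ := existsUnique_gauge212 D hc x
  refine ⟨n, hn, hR, ?_, ?_⟩
  · rw [map_sub, QE_dE_eq_zero D c n hn, sub_zero]
  · have h := LinearMap.congr_fun (curlCurl_comp_dE (P := P) c) n
    simp only [LinearMap.comp_apply, LinearMap.zero_apply] at h
    rw [map_sub, map_sub, h, sub_zero]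

/-- **(127) FOR `x` ⇒ (133) FOR ITS SLICE REPRESENTATIVE**: for any map `H` with `Q∘H = id` and `Δ_a`-orthogonality, any real bond field `x` (NO gauge
condition) whose current `∂*∂x + r` is orthogonal to `ker Q`: `(x − ∂λ₀) + Gr = H(Qx + QGr)` for the representative `x − ∂λ₀`, `λ₀ ∈ N(Q′)`.
[cite: Balaban1985Variational, (127) p.297, (133) p.298; Balaban1984PropagatorsII, (2.12) p.225] -/
theorem exists_repr_add_GE_eq_H_of_critical {c : ℝ} (hc : c ≠ 0) {w : BondIdx D → ℝ} (hw : ∀ i, 0 < w i)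
    {H : BondIdxSpace D → BondSpace P} (hHQ : ∀ β, QE D (H β) = β)
    (hHorth : ∀ β δ, QE D δ = 0 → ⟪δ, deltaAE D c w (H β)⟫_ℝ = 0)
    {x r : BondSpace P} (hcrit : ∀ δ, QE D δ = 0 → ⟪δ, dcsE c (dcE c x) + r⟫_ℝ = 0) :
    ∃ n : ScalarSpace P, n ∈ LinearMap.ker (QpE D) ∧ RE D c (dsE c (x - dE c n)) = 0 ∧
      (x - dE c n) + GE D hc hw r = H (QE D x + QE D (GE D hc hw r)) := by
  obtain ⟨n, hn, hR, hQ, hcur⟩ := exists_slice_repr D hc x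
  refine ⟨n, hn, hR, ?_⟩
  have h := add_GE_eq_H_of_critical D hc hw hHQ hHorth hR (r := r) (fun δ hδ => by rw [hcur]; exact hcrit δ hδ)
  rwa [hQ] at h

end General

/-! ## §2 At the d = 3 carrier: the representative is bounded by the current remainder and the datum of `x` -/

section T3

open scoped Matrix.Norms.L2Operator
open T3ContinuumYM3Torus (T3Family)
open Prop7FlatCoercivityR (succ_le_T3)
open B5Hk163Decay (MG163)
open B5Hk163Strip (kappa163)
open B4TorusKernel (periodConst)
open B4Sect5Proof (latticeConst)
open B5G183Strip (kappa183)
open B5G183CovDecay (MD183)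
open B10Eq68TorusRegularity (plaqFT covDivT)
open B7Prop2Explicit (unitaryUnits)

/-- **GAUGE-FREE CRITICAL-POINT REGULARITY AT THE CARRIER**: for ANY real bond field `x` on the fine torus of run `K` with `⟨δ, ∂*∂x + r⟩ = 0` for
`Q_{K−n}δ = 0`, `sup|r| ≤ B`, `sup|Q_{K−n}x| ≤ β`, the slice representative `x − ∂λ₀` (`λ₀ ∈ N(Q′)`, `R∂*(x − ∂λ₀) = 0`) satisfies
`|(x − ∂λ₀)(e)| ≤ C_G·B + C_H·(β + C_G·B)` with the ABSOLUTE constants of `Prop7FlatSliceRegularity.abs_le_of_critical_T3`.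
[cite: Balaban1985Variational, (127) p.297, (133)-(136) p.298; Balaban1984PropagatorsII, (2.12) p.225] -/
theorem exists_repr_abs_le_of_critical_T3 (F : T3Family) (n K : ℕ)
    {w : BondIdx (twoScale (K - n) (succ_le_T3 F n K) (∅ : Finset (Site (F.P K) (K - n + 1)))) → ℝ}
    (hw : ∀ i, 0 < w i) (hwa : ∀ p, w p = ((F.L : ℝ) ^ (K - n)) ^ 3) (x r : BondSpace (F.P K))
    (hcrit : ∀ δ, QE (twoScale (K - n) (succ_le_T3 F n K) (∅ : Finset (Site (F.P K) (K - n + 1)))) δ = 0 →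
      ⟪δ, dcsE ((F.L : ℝ) ^ (K - n)) (dcE ((F.L : ℝ) ^ (K - n)) x) + r⟫_ℝ = 0)
    {B β : ℝ} (hB : ∀ e, |r e| ≤ B) (hβ : ∀ c', |bondAvgIter (K - n) (WithLp.ofLp x) c'| ≤ β) :
    ∃ lam : ScalarSpace (F.P K), lam ∈ LinearMap.ker (QpE (twoScale (K - n) (succ_le_T3 F n K) (∅ : Finset (Site (F.P K) (K - n + 1))))) ∧
      RE (twoScale (K - n) (succ_le_T3 F n K) (∅ : Finset (Site (F.P K) (K - n + 1)))) ((F.L : ℝ) ^ (K - n))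
        (dsE ((F.L : ℝ) ^ (K - n)) (x - dE ((F.L : ℝ) ^ (K - n)) lam)) = 0 ∧
      ∀ e : PBond (F.P K) 0, |(x - dE ((F.L : ℝ) ^ (K - n)) lam) e|
        ≤ (16 * Real.exp (1 / 6) * latticeConst 3 (1 / 6) + 3 * (MD183 3 2 * periodConst (kappa183 3) 2 * latticeConst 3 (kappa183 3 / 3))) * B
          + MG163 3 * periodConst (kappa163 3) 2 * (3 * latticeConst 3 (kappa163 3 / 3))
            * (β + (16 * Real.exp (1 / 6) * latticeConst 3 (1 / 6)
                + 3 * (MD183 3 2 * periodConst (kappa183 3) 2 * latticeConst 3 (kappa183 3 / 3))) * B) := by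
  have hc : ((F.L : ℝ)) ^ (K - n) ≠ 0 := pow_ne_zero (K - n) (Nat.cast_ne_zero.2 (F.P K).L_pos.ne')
  obtain ⟨lam, hlam, hR, hQ, hcur⟩ := exists_slice_repr (twoScale (K - n) (succ_le_T3 F n K) ∅) hc x
  refine ⟨lam, hlam, hR, fun e => ?_⟩
  have hβ' : ∀ c', |bondAvgIter (K - n) (WithLp.ofLp (x - dE ((F.L : ℝ) ^ (K - n)) lam)) c'| ≤ β := by
    intro c'
    have h := congrArg (fun v => v (bondIdxOfEmpty (succ_le_T3 F n K) c')) hQ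
    simp only [Prop7FlatSliceRegularity.QE_apply_bondIdxOfEmpty] at h
    rw [h]
    exact hβ c'
  exact abs_le_of_critical_T3 F n K hw hwa (x - dE ((F.L : ℝ) ^ (K - n)) lam) r hR
    (fun δ hδ => by rw [hcur]; exact hcrit δ hδ) hB hβ' e

end T3

/-! ## §3 The nonlinear one-step form without a gauge condition -/

section Nonlinear

open scoped Matrix.Norms.L2Operator
open T3ContinuumYM3Torus (T3Family)
open Prop7FlatCoercivityR (succ_le_T3)
open B5Hk163Decay (MG163)
open B5Hk163Strip (kappa163)
open B4TorusKernel (periodConst)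
open B4Sect5Proof (latticeConst)
open B5G183Strip (kappa183)
open B5G183CovDecay (MD183)
open B10Eq68TorusRegularity (plaqFT covDivT)
open B7Prop2Explicit (unitaryUnits)
open Prop7FlatCurrentLinearisation (norm_div2_curl_sub_covDivT_le_T3)
open Prop7FlatCurlCurl (dcsE_dcE_apply)

/-- **THE CURRENT REMAINDER OF A COMPONENT**: for a unitary-valued `V = 1 + Y` (`a`, `f`, `g` as in `Prop7FlatCurrentLinearisation`), a real-linear `ℓ` of norm
`≤ 1` and `x = ℓ∘Y`: `|c²·ℓ((D^{1*}_V∂V)_μ(s)) − (∂*∂x)(⟨s,μ⟩)| ≤ c²·3·(2af + 2f² + 16ag)` (`∂*∂ = dcsE c ∘ dcE c`, any `c`) — the linearised current of the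
component IS the component of the true current up to third order. [cite: Balaban1985RegularSpaces, (1.2) p.76; Balaban1985Variational, (26)-(28) p.282] -/
theorem abs_current_remainder_le_T3 (F : T3Family) (K : ℕ) (c : ℝ)
    (V : GaugeField (F.P K) 0 (Matrix (Fin 2) (Fin 2) ℂ)ˣ) (hV : ∀ b, V b ∈ unitaryUnits (Matrix (Fin 2) (Fin 2) ℂ))
    {a f g : ℝ} (ha : 0 ≤ a) (hf : 0 ≤ f) (hg : 0 ≤ g)
    (haV : ∀ b, ‖(V b : Matrix (Fin 2) (Fin 2) ℂ) - 1‖ ≤ a)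
    (hfV : ∀ (s : Site (F.P K) 0) (κ μ : Fin 3), ‖plaqFT V κ μ s - 1‖ ≤ f)
    (hgV : ∀ (s : Site (F.P K) 0) (κ ν : Fin 3), ‖(V ⟨s.unshift ν, κ⟩ : Matrix (Fin 2) (Fin 2) ℂ) - V ⟨s, κ⟩‖ ≤ g)
    (ℓ : Matrix (Fin 2) (Fin 2) ℂ →L[ℝ] ℝ) (hℓ : ‖ℓ‖ ≤ 1)
    (x : BondSpace (F.P K)) (hx : ∀ b, x b = ℓ ((V b : Matrix (Fin 2) (Fin 2) ℂ) - 1)) (e : PBond (F.P K) 0) :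
    |c ^ 2 * ℓ (covDivT 1 V e.dir e.src) - dcsE c (dcE c x) e| ≤ c ^ 2 * (3 * (2 * a * f + 2 * f ^ 2 + 16 * a * g)) := by
  have hflat := norm_div2_curl_sub_covDivT_le_T3 F K V hV ha hf hg haV hfV hgV e.src e.dir
  have hlin : ℓ (∑ ν : Fin 3,
      ((((V ⟨e.src.unshift ν, ν⟩ : Matrix (Fin 2) (Fin 2) ℂ) - 1) + ((V ⟨(e.src.unshift ν).shift ν, e.dir⟩ : Matrix (Fin 2) (Fin 2) ℂ) - 1)
          - ((V ⟨(e.src.unshift ν).shift e.dir, ν⟩ : Matrix (Fin 2) (Fin 2) ℂ) - 1) - ((V ⟨e.src.unshift ν, e.dir⟩ : Matrix (Fin 2) (Fin 2) ℂ) - 1))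
        - (((V ⟨e.src, ν⟩ : Matrix (Fin 2) (Fin 2) ℂ) - 1) + ((V ⟨e.src.shift ν, e.dir⟩ : Matrix (Fin 2) (Fin 2) ℂ) - 1)
          - ((V ⟨e.src.shift e.dir, ν⟩ : Matrix (Fin 2) (Fin 2) ℂ) - 1) - ((V ⟨e.src, e.dir⟩ : Matrix (Fin 2) (Fin 2) ℂ) - 1))))
      = ∑ ν : Fin 3,
        ((x ⟨e.src.unshift ν, ν⟩ + x ⟨(e.src.unshift ν).shift ν, e.dir⟩ - x ⟨(e.src.unshift ν).shift e.dir, ν⟩ - x ⟨e.src.unshift ν, e.dir⟩)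
          - (x ⟨e.src, ν⟩ + x ⟨e.src.shift ν, e.dir⟩ - x ⟨e.src.shift e.dir, ν⟩ - x ⟨e.src, e.dir⟩)) := by
    simp only [map_sum, map_sub, map_add, hx]
  have hd : dcsE c (dcE c x) e = c ^ 2 * ∑ ν : Fin 3,
        ((x ⟨e.src.unshift ν, ν⟩ + x ⟨(e.src.unshift ν).shift ν, e.dir⟩ - x ⟨(e.src.unshift ν).shift e.dir, ν⟩ - x ⟨e.src.unshift ν, e.dir⟩)
          - (x ⟨e.src, ν⟩ + x ⟨e.src.shift ν, e.dir⟩ - x ⟨e.src.shift e.dir, ν⟩ - x ⟨e.src, e.dir⟩)) :=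
    dcsE_dcE_apply c x e
  rw [hd, ← hlin, ← mul_sub, ← map_sub, abs_mul, abs_of_nonneg (sq_nonneg c)]
  refine mul_le_mul_of_nonneg_left ?_ (sq_nonneg c)
  have key : ∀ v : Matrix (Fin 2) (Fin 2) ℂ, |ℓ v| ≤ ‖v‖ := fun v => by
    have h := ℓ.le_opNorm v
    rw [Real.norm_eq_abs] at h
    exact h.trans (mul_le_of_le_one_left (norm_nonneg v) hℓ)
  refine (key _).trans ?_
  rw [norm_sub_rev]
  exact hflat

/-- **GAUGE-FREE ONE-STEP NONLINEAR SLICE REGULARITY AT THE d = 3 CARRIER**: let `V = 1 + Y` be unitary-valued in ANY near-identity presentation (`a`, `f`, `g`),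
`ℓ` a real component (`‖ℓ‖ ≤ 1`), `x = ℓ∘Y`, and suppose the component `c²·ℓ∘(D^{1*}_V∂V)` of the TRUE current is a multiplier current of the `(K−n)`-fold
block average (the Euler–Lagrange equation in the form (127)) and `sup|Q_{K−n}x| ≤ β`.  Then the SLICE REPRESENTATIVE `x − ∂λ₀` (`λ₀ ∈ N(Q′)`,
`R∂*(x − ∂λ₀) = 0`) satisfies `sup|x − ∂λ₀| ≤ C_G·B + C_H·(β + C_G·B)`, `B = c²·3(2af + 2f² + 16ag)`, `c = L^{K−n}`, ABSOLUTE `C_G`, `C_H` — no gauge condition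
on the presentation. [cite: Balaban1985Variational, (127) p.297, (133)-(136) p.298, (165) p.303; Balaban1984PropagatorsII, (2.12) p.225] -/
theorem exists_repr_abs_le_of_EL_T3 (F : T3Family) (n K : ℕ)
    {w : BondIdx (twoScale (K - n) (succ_le_T3 F n K) (∅ : Finset (Site (F.P K) (K - n + 1)))) → ℝ}
    (hw : ∀ i, 0 < w i) (hwa : ∀ p, w p = ((F.L : ℝ) ^ (K - n)) ^ 3)
    (V : GaugeField (F.P K) 0 (Matrix (Fin 2) (Fin 2) ℂ)ˣ) (hV : ∀ b, V b ∈ unitaryUnits (Matrix (Fin 2) (Fin 2) ℂ))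
    {a f g : ℝ} (ha : 0 ≤ a) (hf : 0 ≤ f) (hg : 0 ≤ g)
    (haV : ∀ b, ‖(V b : Matrix (Fin 2) (Fin 2) ℂ) - 1‖ ≤ a)
    (hfV : ∀ (s : Site (F.P K) 0) (κ μ : Fin 3), ‖plaqFT V κ μ s - 1‖ ≤ f)
    (hgV : ∀ (s : Site (F.P K) 0) (κ ν : Fin 3), ‖(V ⟨s.unshift ν, κ⟩ : Matrix (Fin 2) (Fin 2) ℂ) - V ⟨s, κ⟩‖ ≤ g)
    (ℓ : Matrix (Fin 2) (Fin 2) ℂ →L[ℝ] ℝ) (hℓ : ‖ℓ‖ ≤ 1)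
    (x : BondSpace (F.P K)) (hx : ∀ b, x b = ℓ ((V b : Matrix (Fin 2) (Fin 2) ℂ) - 1))
    (hEL : ∀ δ : BondSpace (F.P K), QE (twoScale (K - n) (succ_le_T3 F n K) (∅ : Finset (Site (F.P K) (K - n + 1)))) δ = 0 →
      ⟪δ, WithLp.toLp 2 (fun b : PBond (F.P K) 0 => ((F.L : ℝ) ^ (K - n)) ^ 2 * ℓ (covDivT 1 V b.dir b.src))⟫_ℝ = 0)
    {β : ℝ} (hβ : ∀ c', |bondAvgIter (K - n) (WithLp.ofLp x) c'| ≤ β) :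
    ∃ lam : ScalarSpace (F.P K), lam ∈ LinearMap.ker (QpE (twoScale (K - n) (succ_le_T3 F n K) (∅ : Finset (Site (F.P K) (K - n + 1))))) ∧
      RE (twoScale (K - n) (succ_le_T3 F n K) (∅ : Finset (Site (F.P K) (K - n + 1)))) ((F.L : ℝ) ^ (K - n))
        (dsE ((F.L : ℝ) ^ (K - n)) (x - dE ((F.L : ℝ) ^ (K - n)) lam)) = 0 ∧
      ∀ e : PBond (F.P K) 0, |(x - dE ((F.L : ℝ) ^ (K - n)) lam) e|
        ≤ (16 * Real.exp (1 / 6) * latticeConst 3 (1 / 6) + 3 * (MD183 3 2 * periodConst (kappa183 3) 2 * latticeConst 3 (kappa183 3 / 3)))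
            * (((F.L : ℝ) ^ (K - n)) ^ 2 * (3 * (2 * a * f + 2 * f ^ 2 + 16 * a * g)))
          + MG163 3 * periodConst (kappa163 3) 2 * (3 * latticeConst 3 (kappa163 3 / 3))
            * (β + (16 * Real.exp (1 / 6) * latticeConst 3 (1 / 6)
                + 3 * (MD183 3 2 * periodConst (kappa183 3) 2 * latticeConst 3 (kappa183 3 / 3)))
                * (((F.L : ℝ) ^ (K - n)) ^ 2 * (3 * (2 * a * f + 2 * f ^ 2 + 16 * a * g)))) := by
  set c : ℝ := (F.L : ℝ) ^ (K - n) with hc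
  set r : BondSpace (F.P K) := WithLp.toLp 2 (fun b : PBond (F.P K) 0 => c ^ 2 * ℓ (covDivT 1 V b.dir b.src)) - dcsE c (dcE c x) with hr
  have hcrit : ∀ δ : BondSpace (F.P K), QE (twoScale (K - n) (succ_le_T3 F n K) (∅ : Finset (Site (F.P K) (K - n + 1)))) δ = 0 →
      ⟪δ, dcsE c (dcE c x) + r⟫_ℝ = 0 := by
    intro δ hδ
    rw [hr, add_sub_cancel]
    exact hEL δ hδ
  have hrB : ∀ e', |r e'| ≤ c ^ 2 * (3 * (2 * a * f + 2 * f ^ 2 + 16 * a * g)) := by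
    intro e'
    have h := abs_current_remainder_le_T3 F K c V hV ha hf hg haV hfV hgV ℓ hℓ x hx e'
    have hre : r e' = c ^ 2 * ℓ (covDivT 1 V e'.dir e'.src) - dcsE c (dcE c x) e' := by
      rw [hr, PiLp.sub_apply]
    rw [hre]
    exact h
  exact exists_repr_abs_le_of_critical_T3 F n K hw hwa x r hcrit hrB hβ

end Nonlinear

/-! ## §4 The multiplier form: no exact Euler–Lagrange orthogonality, only a defect `p = sup|c²ℓ∘J − Q*ω|` for SOME coarse `ω` (appended) -/

section Multiplier

open scoped Matrix.Norms.L2Operator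
open T3ContinuumYM3Torus (T3Family)
open Prop7FlatCoercivityR (succ_le_T3)
open B5Hk163Decay (MG163)
open B5Hk163Strip (kappa163)
open B4TorusKernel (periodConst)
open B4Sect5Proof (latticeConst)
open B5G183Strip (kappa183)
open B5G183CovDecay (MD183)
open B10Eq68TorusRegularity (plaqFT covDivT)
open B7Prop2Explicit (unitaryUnits)
open Prop7FlatSliceRegularity (abs_le_of_slice_T3)

/-- **THE INTERFACE FOR THE EULER–LAGRANGE PORT**: let `V = 1 + Y` be unitary-valued in any near-identity presentation (`a`, `f`, `g`), `ℓ` a real component,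
`x = ℓ∘Y`, `sup|Q_{K−n}x| ≤ β`, and let `ω` be ANY coarse field (a candidate multiplier) with E–L∕port DEFECT `|c²·ℓ((D^{1*}_V∂V)(e)) − (Q*ω)(e)| ≤ p` at every
bond.  Then the slice representative `x − ∂λ₀` (`λ₀ ∈ N(Q′)`, `R∂*(x − ∂λ₀) = 0`) satisfies
`|(x − ∂λ₀)(e)| ≤ C_G·(B + p) + C_H·(β + C_G·(B + p))`, `B = c²·3(2af + 2f² + 16ag)` — sup norm ≤ C·(Taylor remainder + E–L∕port defect + datum), ABSOLUTE
constants, no gauge condition, no exact orthogonality. [cite: Balaban1985Variational, (127)-(128) p.297, (133)-(136) p.298, (165) p.303] -/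
theorem exists_repr_abs_le_of_multiplier_T3 (F : T3Family) (n K : ℕ)
    {w : BondIdx (twoScale (K - n) (succ_le_T3 F n K) (∅ : Finset (Site (F.P K) (K - n + 1)))) → ℝ}
    (hw : ∀ i, 0 < w i) (hwa : ∀ p, w p = ((F.L : ℝ) ^ (K - n)) ^ 3)
    (V : GaugeField (F.P K) 0 (Matrix (Fin 2) (Fin 2) ℂ)ˣ) (hV : ∀ b, V b ∈ unitaryUnits (Matrix (Fin 2) (Fin 2) ℂ))
    {a f g : ℝ} (ha : 0 ≤ a) (hf : 0 ≤ f) (hg : 0 ≤ g)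
    (haV : ∀ b, ‖(V b : Matrix (Fin 2) (Fin 2) ℂ) - 1‖ ≤ a)
    (hfV : ∀ (s : Site (F.P K) 0) (κ μ : Fin 3), ‖plaqFT V κ μ s - 1‖ ≤ f)
    (hgV : ∀ (s : Site (F.P K) 0) (κ ν : Fin 3), ‖(V ⟨s.unshift ν, κ⟩ : Matrix (Fin 2) (Fin 2) ℂ) - V ⟨s, κ⟩‖ ≤ g)
    (ℓ : Matrix (Fin 2) (Fin 2) ℂ →L[ℝ] ℝ) (hℓ : ‖ℓ‖ ≤ 1)
    (x : BondSpace (F.P K)) (hx : ∀ b, x b = ℓ ((V b : Matrix (Fin 2) (Fin 2) ℂ) - 1))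
    (ω : BondIdxSpace (twoScale (K - n) (succ_le_T3 F n K) (∅ : Finset (Site (F.P K) (K - n + 1))))) {p : ℝ}
    (hω : ∀ e : PBond (F.P K) 0, |((F.L : ℝ) ^ (K - n)) ^ 2 * ℓ (covDivT 1 V e.dir e.src)
      - QsE (twoScale (K - n) (succ_le_T3 F n K) (∅ : Finset (Site (F.P K) (K - n + 1)))) ω e| ≤ p)
    {β : ℝ} (hβ : ∀ c', |bondAvgIter (K - n) (WithLp.ofLp x) c'| ≤ β) :
    ∃ lam : ScalarSpace (F.P K), lam ∈ LinearMap.ker (QpE (twoScale (K - n) (succ_le_T3 F n K) (∅ : Finset (Site (F.P K) (K - n + 1))))) ∧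
      RE (twoScale (K - n) (succ_le_T3 F n K) (∅ : Finset (Site (F.P K) (K - n + 1)))) ((F.L : ℝ) ^ (K - n))
        (dsE ((F.L : ℝ) ^ (K - n)) (x - dE ((F.L : ℝ) ^ (K - n)) lam)) = 0 ∧
      ∀ e : PBond (F.P K) 0, |(x - dE ((F.L : ℝ) ^ (K - n)) lam) e|
        ≤ (16 * Real.exp (1 / 6) * latticeConst 3 (1 / 6) + 3 * (MD183 3 2 * periodConst (kappa183 3) 2 * latticeConst 3 (kappa183 3 / 3)))
            * (((F.L : ℝ) ^ (K - n)) ^ 2 * (3 * (2 * a * f + 2 * f ^ 2 + 16 * a * g)) + p)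
          + MG163 3 * periodConst (kappa163 3) 2 * (3 * latticeConst 3 (kappa163 3 / 3))
            * (β + (16 * Real.exp (1 / 6) * latticeConst 3 (1 / 6)
                + 3 * (MD183 3 2 * periodConst (kappa183 3) 2 * latticeConst 3 (kappa183 3 / 3)))
                * (((F.L : ℝ) ^ (K - n)) ^ 2 * (3 * (2 * a * f + 2 * f ^ 2 + 16 * a * g)) + p)) := by
  set c : ℝ := (F.L : ℝ) ^ (K - n) with hc
  have hc0 : c ≠ 0 := pow_ne_zero (K - n) (Nat.cast_ne_zero.2 (F.P K).L_pos.ne')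
  obtain ⟨lam, hlam, hR, hQ, hcur⟩ := exists_slice_repr (twoScale (K - n) (succ_le_T3 F n K) ∅) hc0 x
  refine ⟨lam, hlam, hR, fun e => ?_⟩
  have hβ' : ∀ c', |bondAvgIter (K - n) (WithLp.ofLp (x - dE c lam)) c'| ≤ β := by
    intro c'
    have h := congrArg (fun v => v (bondIdxOfEmpty (succ_le_T3 F n K) c')) hQ
    simp only [Prop7FlatSliceRegularity.QE_apply_bondIdxOfEmpty] at h
    rw [h]
    exact hβ c'
  -- the current of the representative against the candidate multiplier: Taylor remainder + defect
  have hB : ∀ e', |(dcsE c (dcE c (x - dE c lam)) - QsE (twoScale (K - n) (succ_le_T3 F n K) (∅ : Finset (Site (F.P K) (K - n + 1)))) ω) e'|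
      ≤ c ^ 2 * (3 * (2 * a * f + 2 * f ^ 2 + 16 * a * g)) + p := by
    intro e'
    have h1 := abs_current_remainder_le_T3 F K c V hV ha hf hg haV hfV hgV ℓ hℓ x hx e'
    have h2 := hω e'
    rw [hcur, PiLp.sub_apply]
    have e1 : dcsE c (dcE c x) e' - QsE (twoScale (K - n) (succ_le_T3 F n K) (∅ : Finset (Site (F.P K) (K - n + 1)))) ω e'
        = -(c ^ 2 * ℓ (covDivT 1 V e'.dir e'.src) - dcsE c (dcE c x) e')
          + (c ^ 2 * ℓ (covDivT 1 V e'.dir e'.src) - QsE (twoScale (K - n) (succ_le_T3 F n K) (∅ : Finset (Site (F.P K) (K - n + 1)))) ω e') := by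
      ring
    rw [e1]
    refine (abs_add_le _ _).trans (add_le_add ?_ h2)
    rw [abs_neg]
    exact h1
  exact abs_le_of_slice_T3 F n K hw hwa (x - dE c lam) hR ω hB hβ' e

end Multiplier

/-! ## §5 The gradient member of the multiplier form (`C = C(L)`, appended) -/

section MultiplierGrad

open scoped Matrix.Norms.L2Operator
open T3ContinuumYM3Torus (T3Family)
open Prop7FlatCoercivityR (succ_le_T3)
open B10Eq68TorusRegularity (plaqFT covDivT)
open B7Prop2Explicit (unitaryUnits)
open Prop7FlatSliceRegularity (exists_slice_grad_regularity_T3)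

/-- **GRADIENT MEMBER OF THE PORT INTERFACE**: for a block size `L` there is `C = C(L) > 0` such that, in the setting of `exists_repr_abs_le_of_multiplier_T3`
(member `F` with `F.L = L`, heights `n < K`), the slice representative also satisfies `L^{K−n}·|(x − ∂λ₀)(⟨s+e_ν,μ⟩) − (x − ∂λ₀)(⟨s,μ⟩)| ≤ C·((B + p) + β)`
— the second member of [Balaban1985RegularSpaces] (1.136) / [Balaban1985Variational] (165) for the component, one step.
[cite: Balaban1985Variational, (165) p.303; Balaban1985RegularSpaces, (1.136) p.99] -/
theorem exists_repr_grad_le_of_multiplier_T3 (L : ℕ) (hL : Odd L ∧ 1 < L) : ∃ C : ℝ, 0 < C ∧ ∀ (F : T3Family), F.L = L → ∀ (n K : ℕ), n < K →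
    ∀ (w : BondIdx (twoScale (K - n) (succ_le_T3 F n K) (∅ : Finset (Site (F.P K) (K - n + 1)))) → ℝ)
    (hw : ∀ i, 0 < w i), (∀ p, w p = ((F.L : ℝ) ^ (K - n)) ^ 3) →
    ∀ (V : GaugeField (F.P K) 0 (Matrix (Fin 2) (Fin 2) ℂ)ˣ), (∀ b, V b ∈ unitaryUnits (Matrix (Fin 2) (Fin 2) ℂ)) →
    ∀ (a f g : ℝ), 0 ≤ a → 0 ≤ f → 0 ≤ g →
    (∀ b, ‖(V b : Matrix (Fin 2) (Fin 2) ℂ) - 1‖ ≤ a) →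
    (∀ (s : Site (F.P K) 0) (κ μ : Fin 3), ‖plaqFT V κ μ s - 1‖ ≤ f) →
    (∀ (s : Site (F.P K) 0) (κ ν : Fin 3), ‖(V ⟨s.unshift ν, κ⟩ : Matrix (Fin 2) (Fin 2) ℂ) - V ⟨s, κ⟩‖ ≤ g) →
    ∀ (ℓ : Matrix (Fin 2) (Fin 2) ℂ →L[ℝ] ℝ), ‖ℓ‖ ≤ 1 →
    ∀ (x : BondSpace (F.P K)), (∀ b, x b = ℓ ((V b : Matrix (Fin 2) (Fin 2) ℂ) - 1)) →
    ∀ (ω : BondIdxSpace (twoScale (K - n) (succ_le_T3 F n K) (∅ : Finset (Site (F.P K) (K - n + 1))))) (p : ℝ),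
    (∀ e : PBond (F.P K) 0, |((F.L : ℝ) ^ (K - n)) ^ 2 * ℓ (covDivT 1 V e.dir e.src)
      - QsE (twoScale (K - n) (succ_le_T3 F n K) (∅ : Finset (Site (F.P K) (K - n + 1)))) ω e| ≤ p) →
    ∀ (β : ℝ), 0 ≤ β → (∀ c', |bondAvgIter (K - n) (WithLp.ofLp x) c'| ≤ β) →
    ∃ lam : ScalarSpace (F.P K), lam ∈ LinearMap.ker (QpE (twoScale (K - n) (succ_le_T3 F n K) (∅ : Finset (Site (F.P K) (K - n + 1))))) ∧
      RE (twoScale (K - n) (succ_le_T3 F n K) (∅ : Finset (Site (F.P K) (K - n + 1)))) ((F.L : ℝ) ^ (K - n))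
        (dsE ((F.L : ℝ) ^ (K - n)) (x - dE ((F.L : ℝ) ^ (K - n)) lam)) = 0 ∧
      ∀ (s : Site (F.P K) 0) (μ ν : Fin 3),
        (F.L : ℝ) ^ (K - n) * |(x - dE ((F.L : ℝ) ^ (K - n)) lam) ⟨s.shift ν, μ⟩ - (x - dE ((F.L : ℝ) ^ (K - n)) lam) ⟨s, μ⟩|
          ≤ C * ((((F.L : ℝ) ^ (K - n)) ^ 2 * (3 * (2 * a * f + 2 * f ^ 2 + 16 * a * g)) + p) + β) := by
  obtain ⟨C, hC, hgrad⟩ := exists_slice_grad_regularity_T3 L hL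
  refine ⟨C, hC, fun F hFL n K hnK w hw hwa V hV a f g ha hf hg haV hfV hgV ℓ hℓ x hx ω p hω β hβ0 hβ => ?_⟩
  set c : ℝ := (F.L : ℝ) ^ (K - n) with hc
  have hc0 : c ≠ 0 := pow_ne_zero (K - n) (Nat.cast_ne_zero.2 (F.P K).L_pos.ne')
  obtain ⟨lam, hlam, hR, hQ, hcur⟩ := exists_slice_repr (twoScale (K - n) (succ_le_T3 F n K) ∅) hc0 x
  refine ⟨lam, hlam, hR, fun s μ ν => ?_⟩
  have hβ' : ∀ c', |bondAvgIter (K - n) (WithLp.ofLp (x - dE c lam)) c'| ≤ β := by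
    intro c'
    have h := congrArg (fun v => v (bondIdxOfEmpty (succ_le_T3 F n K) c')) hQ
    simp only [Prop7FlatSliceRegularity.QE_apply_bondIdxOfEmpty] at h
    rw [h]
    exact hβ c'
  have hB : ∀ e', |(dcsE c (dcE c (x - dE c lam)) - QsE (twoScale (K - n) (succ_le_T3 F n K) (∅ : Finset (Site (F.P K) (K - n + 1)))) ω) e'|
      ≤ c ^ 2 * (3 * (2 * a * f + 2 * f ^ 2 + 16 * a * g)) + p := by
    intro e'
    have h1 := abs_current_remainder_le_T3 F K c V hV ha hf hg haV hfV hgV ℓ hℓ x hx e'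
    have h2 := hω e'
    rw [hcur, PiLp.sub_apply]
    have e1 : dcsE c (dcE c x) e' - QsE (twoScale (K - n) (succ_le_T3 F n K) (∅ : Finset (Site (F.P K) (K - n + 1)))) ω e'
        = -(c ^ 2 * ℓ (covDivT 1 V e'.dir e'.src) - dcsE c (dcE c x) e')
          + (c ^ 2 * ℓ (covDivT 1 V e'.dir e'.src) - QsE (twoScale (K - n) (succ_le_T3 F n K) (∅ : Finset (Site (F.P K) (K - n + 1)))) ω e') := by
      ring
    rw [e1]
    refine (abs_add_le _ _).trans (add_le_add ?_ h2)
    rw [abs_neg]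
    exact h1
  have hBp0 : 0 ≤ c ^ 2 * (3 * (2 * a * f + 2 * f ^ 2 + 16 * a * g)) + p := by
    obtain ⟨e₀⟩ : Nonempty (PBond (F.P K) 0) := ⟨⟨fun _ => 0, ⟨0, (F.P K).hd⟩⟩⟩
    exact (abs_nonneg _).trans (hB e₀)
  exact hgrad F hFL n K hnK w hw hwa (x - dE c lam) hR ω _ β hBp0 hβ0 hB hβ' s μ ν

end MultiplierGrad

end Summit.QuantumFields.YangMills.Theorems.Prop7FlatSliceRegularityGauge

end
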